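import Summits.QuantumFields.BalabanUV.T4Continuum.Support.NE7K1LinRegionLine

/-!
# NE7K1LinRegionCovEnergy — row NE7 (node U5), candidate route HOM, path H1L, cell K1-lin(s): NEEDS-ESTIMATE #E1 (o3-Ω) —
# B4 (1.13)–(1.15) FOR THE TWO-CUTOFF LINE ON EVERY FINITE UNION `Ω^{(j)}` OF `L_P`-BLOCKS (the print's regions): the
# unit-lattice operator `Δ_s^{(j)}(Ω) = aI − a²Q_n(T^Ω(s))⁻¹Q_n^*`, the covariance operator `Δ_s^{(j)}(Ω) + a₂L_P^{−2}P`, and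
# `γ₀I ≤ Δ_s^{(j)}(Ω) + a₂L_P^{−2}P ≤ γ₁I` with b04's REGION constants, EVERY `s ∈ [0,1]`, EVERY mesh, EVERY region

Lineage `b2b-balaban-t4-ne7-p2` (CRUX PROVER NE7 #2), generation 78; file 88.  b04's `B4RegionCov1518` §4 (the print's Section-5
route (5.1)–(5.3) at `A = 0` on general block unions) re-run with the fine operator generalised to the region line of file 87.
THE ONE NEW LINE: the INVERSE-ANTITONE LEVER `⟨g,(T^Ω(s))⁻¹g⟩ ≤ ⟨g,G_j(Ω,0)g⟩` (file 87 `regLine_inv_form_le`) gives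
`Δ_s^{(j)}(Ω) ⪰ Δ_0^{(j)}(Ω) = b04's KeffR n a 0 Ω` as quadratic forms (`KeffR_form_le_KeffLR`), so b04's (1.22)-at-`A = 0`
floor `KeffR_form_ge` and its (1.15) floor `covR_form_ge` pass to the line VERBATIM, for every `s`.

* §1 **`KeffLR L hn Ω a s`** `= a·1 − (a²∕n^{d+1})·indR·(T^Ω(s))⁻¹·indRᵀ` (B4 (1.14) for the line on `Ω^{(j)}`); `KeffLR_isSymm`,
  `KeffLR_form_eq`, **`KeffR_form_le_KeffLR`**, **`KeffLR_form_ge`** (`min(a∕(8(d+1)),1∕8)·E_Ω(ψ) ≤ ⟨ψ,Δ_s(Ω)ψ⟩`, `E_Ω` = b04's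
  bond form `dirS Ω (extS Ω ψ)`), `KeffLR_form_le` (`≤ a‖ψ‖²`), `KeffLR_zero` (`= KeffR n a 0 Ω`).
* §2 **`covLR L hn LP Ω a a₂ s`** `= KeffLR + (a₂∕L_P²)·projL L_P Ω` (B4 (1.13)'s operator; `L_P` = the NEXT step's block, b04's
  `projL`); `covLR_isSymm`, `covLR_form_eq`, **`covR_form_le_covLR`**, **`covLR_form_ge`** = (1.15) LOWER:
  `min(a∕(8(d+1)),1∕8)·min(2,a₂)∕L_P²·‖ψ‖² ≤ ⟨ψ,(Δ_s(Ω)+a₂L_P^{−2}P)ψ⟩` for `Ω^{(j)}` a union of `L_P`-blocks (b04's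
  `covR_form_ge` at `m² = 0` behind the lever), **`covLR_form_le`** = (1.15) UPPER `≤ (a + a₂∕L_P²)‖ψ‖²`, `covLR_isUnit ∕ _mul_inv`.
Constants: `(d, a, a₂, L_P)` only — no `s`, `n`, `L`, `Ω` (the two-run refinement `L` does not enter (1.15)).

HONEST FRAMING: [folklore]; A = 0; Neumann regions; nothing of Bałaban's asserted; no `sorry`.  Census only; NE7 NOT PRINTED ∕ NOT
PROVED; spine 0∕9; FIXED FINITE T⁴, rung (B)+1; NOT infinite volume, NOT mass gap, NOT Clay.  HONEST DEPENDENCY: continuum YM on T⁴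
⇐ BetaPertH ∧ nine spine estimates (0/9 proved); BetaPertH ⇐ (D1) ∧ (D4) ∧ CAP+tail; G-an2-4 gates asym, D1 and NE2/3/4.
-/

noncomputable section

open Finset Matrix

namespace Summit.QuantumFields.BalabanUV.T4Continuum.NE7K1LinRegionCovEnergy

open Literature.MathematicalPhysics.QuantumFieldTheory.Balaban1983to89
open Literature.MathematicalPhysics.QuantumFieldTheory.Balaban1983to89.B4Reflection242
open Literature.MathematicalPhysics.QuantumFieldTheory.Balaban1983to89.B4Lower18
open Literature.MathematicalPhysics.QuantumFieldTheory.Balaban1983to89.B4Prop31Zero (indR KeffR KeffR_form_eq KeffR_form_ge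
  extS dirS dirS_nonneg)
open Literature.MathematicalPhysics.QuantumFieldTheory.Balaban1983to89.B4RegionCov1518 (projL projL_isSymm projL_form_le covR
  covR_form_eq covR_form_ge)
open NE7K1LinSchurLineForm NE7K1LinRegionLine

variable {d : ℕ}

/-! ### §1 `Δ_s^{(j)}(Ω) = aI − a²Q_n(T^Ω(s))⁻¹Q_n^*` on `ℓ²(Ω^{(j)})` -/

section Keff

variable {n : ℕ} (L : ℕ) [NeZero L] {Ω : Finset (Fin (d + 1) → ℤ)}

/-- **B4 (1.14) FOR THE LINE ON A REGION**: `Δ_s^{(j)}(Ω) = a·1 − (a²∕n^{d+1})·indR·(T^Ω(s))⁻¹·indRᵀ` on the unit sites `Ω^{(j)}`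
(b04's `KeffR` with `G_j(Ω,0) ↦ (T^Ω(s))⁻¹`). [folklore] -/
def KeffLR (hn : 1 ≤ n) (Ω : Finset (Fin (d + 1) → ℤ)) (a s : ℝ) : Matrix ↥Ω ↥Ω ℝ :=
  a • (1 : Matrix ↥Ω ↥Ω ℝ) - (a ^ 2 * ((n : ℝ) ^ (d + 1))⁻¹) • (indR n Ω * (regLine L hn Ω a s)⁻¹ * (indR n Ω)ᵀ)

/-- `Δ_s^{(j)}(Ω)` is symmetric. [folklore] -/
theorem KeffLR_isSymm (hn : 1 ≤ n) (a s : ℝ) : (KeffLR L hn Ω a s).IsSymm := by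
  have hG := regLine_inv_isSymm L hn a s (Ω := Ω)
  unfold Matrix.IsSymm at hG ⊢
  simp only [KeffLR, Matrix.transpose_sub, Matrix.transpose_smul, Matrix.transpose_one, Matrix.transpose_mul,
    Matrix.transpose_transpose, hG, Matrix.mul_assoc]

/-- the form of `Δ_s^{(j)}(Ω)`: `ψ ⬝ Δψ = a‖ψ‖² − (a²∕n^{d+1})·(indRᵀψ) ⬝ (T^Ω(s))⁻¹(indRᵀψ)`. [folklore] -/
theorem KeffLR_form_eq (hn : 1 ≤ n) (a s : ℝ) (ψ : ↥Ω → ℝ) :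
    ψ ⬝ᵥ (KeffLR L hn Ω a s).mulVec ψ
      = a * (ψ ⬝ᵥ ψ) - a ^ 2 * ((n : ℝ) ^ (d + 1))⁻¹ *
          ((indR n Ω)ᵀ.mulVec ψ ⬝ᵥ ((regLine L hn Ω a s)⁻¹).mulVec ((indR n Ω)ᵀ.mulVec ψ)) := by
  rw [KeffLR, Matrix.sub_mulVec, Matrix.smul_mulVec, Matrix.one_mulVec, dotProduct_sub, dotProduct_smul,
    smul_eq_mul, Matrix.smul_mulVec, dotProduct_smul, smul_eq_mul, ← Matrix.mulVec_mulVec, ← Matrix.mulVec_mulVec,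
    Matrix.dotProduct_mulVec ψ (indR n Ω), ← Matrix.mulVec_transpose]

/-- at `s = 0`, `Δ_0^{(j)}(Ω)` IS b04's `Δ^{(j)}(Ω,0)` at `m² = 0`. [folklore] -/
theorem KeffLR_zero (hn : 1 ≤ n) (a : ℝ) : KeffLR L hn Ω a 0 = KeffR n a 0 Ω := by
  simp only [KeffLR, KeffR, regLine_zero]

/-- **THE LEVER AT THE UNIT LATTICE**: `⟨ψ, Δ^{(j)}(Ω,0)ψ⟩ ≤ ⟨ψ, Δ_s^{(j)}(Ω)ψ⟩` for every `s ≥ 0` (`a > 0`) — from the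
inverse-antitone lever on the fine region. [folklore] -/
theorem KeffR_form_le_KeffLR (hn : 1 ≤ n) {a : ℝ} (ha : 0 < a) {s : ℝ} (hs : 0 ≤ s) (ψ : ↥Ω → ℝ) :
    ψ ⬝ᵥ (KeffR n a 0 Ω).mulVec ψ ≤ ψ ⬝ᵥ (KeffLR L hn Ω a s).mulVec ψ := by
  rw [KeffR_form_eq, KeffLR_form_eq]
  have h := regLine_inv_form_le L hn ha hs ((indR n Ω)ᵀ.mulVec ψ)
  have hc : 0 ≤ a ^ 2 * ((n : ℝ) ^ (d + 1))⁻¹ := by positivity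
  nlinarith [mul_le_mul_of_nonneg_left h hc]

/-- **B4 (1.22) AT `A = 0` FOR THE LINE ON A REGION** (b04's `KeffR_form_ge` at `m² = 0` behind the lever):
`min(a∕(8(d+1)), 1∕8)·E_Ω(ψ) ≤ ⟨ψ, Δ_s^{(j)}(Ω)ψ⟩` for every `s ≥ 0`, `E_Ω(ψ) = dirS Ω (extS Ω ψ)` b04's unit bond form of
`Ω^{(j)}`. [folklore] -/
theorem KeffLR_form_ge (hn : 1 ≤ n) {a : ℝ} (ha : 0 < a) {s : ℝ} (hs : 0 ≤ s) (ψ : ↥Ω → ℝ) :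
    min (a / (8 * (d + 1))) (1 / 8) * dirS Ω (extS Ω ψ) ≤ ψ ⬝ᵥ (KeffLR L hn Ω a s).mulVec ψ := by
  have h := KeffR_form_ge hn ha le_rfl Ω ψ
  rw [mul_zero, add_zero, zero_mul, add_zero] at h
  exact h.trans (KeffR_form_le_KeffLR L hn ha hs ψ)

/-- `⟨ψ, Δ_s^{(j)}(Ω)ψ⟩ ≤ a‖ψ‖²` (the Green form of the line is nonnegative). [folklore] -/
theorem KeffLR_form_le (hn : 1 ≤ n) {a : ℝ} (ha : 0 < a) {s : ℝ} (hs : 0 ≤ s) (ψ : ↥Ω → ℝ) :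
    ψ ⬝ᵥ (KeffLR L hn Ω a s).mulVec ψ ≤ a * (ψ ⬝ᵥ ψ) := by
  rw [KeffLR_form_eq]
  have h := regLine_inv_form_nonneg L hn ha hs ((indR n Ω)ᵀ.mulVec ψ)
  have hc : 0 ≤ a ^ 2 * ((n : ℝ) ^ (d + 1))⁻¹ := by positivity
  nlinarith [mul_nonneg hc h]

end Keff

/-! ### §2 The covariance operator `Δ_s^{(j)}(Ω) + a₂L_P^{−2}P` and B4 (1.15) for the line on a region -/

section Cov

variable {n : ℕ} (L : ℕ) [NeZero L] {Ω : Finset (Fin (d + 1) → ℤ)}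

/-- **B4 (1.13)'s OPERATOR FOR THE LINE ON A REGION**: `Δ_s^{(j)}(Ω) + (a₂∕L_P²)·P`, `P = projL L_P Ω` the `L_P`-block averaging
projection of the unit sites (`L_P` = the NEXT step's block). [folklore] -/
def covLR (hn : 1 ≤ n) (LP : ℕ) (Ω : Finset (Fin (d + 1) → ℤ)) (a a₂ s : ℝ) : Matrix ↥Ω ↥Ω ℝ :=
  KeffLR L hn Ω a s + (a₂ / (LP : ℝ) ^ 2) • projL LP Ω

/-- the covariance operator is symmetric. [folklore] -/
theorem covLR_isSymm (hn : 1 ≤ n) (LP : ℕ) (a a₂ s : ℝ) : (covLR L hn LP Ω a a₂ s).IsSymm :=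
  (KeffLR_isSymm L hn a s).add ((projL_isSymm LP Ω).smul _)

/-- the quadratic form splits. [folklore] -/
theorem covLR_form_eq (hn : 1 ≤ n) (LP : ℕ) (a a₂ s : ℝ) (ψ : ↥Ω → ℝ) :
    ψ ⬝ᵥ (covLR L hn LP Ω a a₂ s).mulVec ψ
      = ψ ⬝ᵥ (KeffLR L hn Ω a s).mulVec ψ + a₂ / (LP : ℝ) ^ 2 * (ψ ⬝ᵥ (projL LP Ω).mulVec ψ) := by
  simp only [covLR, Matrix.add_mulVec, Matrix.smul_mulVec, dotProduct_add, dotProduct_smul, smul_eq_mul]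

/-- **THE LEVER FOR THE COVARIANCE OPERATOR**: `⟨ψ,(Δ^{(j)}(Ω,0) + a₂L_P^{−2}P)ψ⟩ ≤ ⟨ψ,(Δ_s^{(j)}(Ω) + a₂L_P^{−2}P)ψ⟩` (`s ≥ 0`) —
b04's `covR n L_P a a₂ 0 Ω` is BELOW the line's. [folklore] -/
theorem covR_form_le_covLR (hn : 1 ≤ n) (LP : ℕ) {a : ℝ} (ha : 0 < a) (a₂ : ℝ) {s : ℝ} (hs : 0 ≤ s) (ψ : ↥Ω → ℝ) :
    ψ ⬝ᵥ (covR n LP a a₂ 0 Ω).mulVec ψ ≤ ψ ⬝ᵥ (covLR L hn LP Ω a a₂ s).mulVec ψ := by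
  rw [covR_form_eq, covLR_form_eq]
  have h := KeffR_form_le_KeffLR L hn ha hs ψ
  linarith

/-- **B4 (1.15) FOR THE LINE ON A REGION, LOWER BOUND — EVERY FINITE UNION `Ω^{(j)}` OF `L_P`-BLOCKS, EVERY MESH, EVERY
`s ≥ 0`, b04's EXPLICIT CONSTANT**: `min(a∕(8(d+1)), 1∕8)·min(2,a₂)∕L_P²·‖ψ‖² ≤ ⟨ψ, (Δ_s^{(j)}(Ω) + a₂L_P^{−2}P)ψ⟩`
(b04's `covR_form_ge` at `m² = 0` behind the lever). [folklore] -/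
theorem covLR_form_ge (hn : 1 ≤ n) {LP : ℕ} (hLP : 1 ≤ LP) {a a₂ : ℝ} (ha : 0 < a) (ha2 : 0 ≤ a₂) {s : ℝ} (hs : 0 ≤ s)
    (hΩ : IsBlockUnion LP Ω) (ψ : ↥Ω → ℝ) :
    min (a / (8 * (d + 1))) (1 / 8) * (min 2 a₂ / (LP : ℝ) ^ 2) * (ψ ⬝ᵥ ψ)
      ≤ ψ ⬝ᵥ (covLR L hn LP Ω a a₂ s).mulVec ψ := by
  have h := covR_form_ge hn hLP ha ha2 le_rfl hΩ ψ (n := n)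
  rw [mul_zero, add_zero] at h
  exact h.trans (covR_form_le_covLR L hn LP ha a₂ hs ψ)

/-- **B4 (1.15) FOR THE LINE ON A REGION, UPPER BOUND**: `⟨ψ, (Δ_s^{(j)}(Ω) + a₂L_P^{−2}P)ψ⟩ ≤ (a + a₂∕L_P²)‖ψ‖²` on a union of
`L_P`-blocks. [folklore] -/
theorem covLR_form_le (hn : 1 ≤ n) {LP : ℕ} (hLP : 1 ≤ LP) {a a₂ : ℝ} (ha : 0 < a) (ha2 : 0 ≤ a₂) {s : ℝ} (hs : 0 ≤ s)
    (hΩ : IsBlockUnion LP Ω) (ψ : ↥Ω → ℝ) :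
    ψ ⬝ᵥ (covLR L hn LP Ω a a₂ s).mulVec ψ ≤ (a + a₂ / (LP : ℝ) ^ 2) * (ψ ⬝ᵥ ψ) := by
  rw [covLR_form_eq]
  have h1 := KeffLR_form_le L hn ha hs ψ
  have h2 := projL_form_le hLP hΩ ψ
  have h3 : a₂ / (LP : ℝ) ^ 2 * (ψ ⬝ᵥ (projL LP Ω).mulVec ψ) ≤ a₂ / (LP : ℝ) ^ 2 * (ψ ⬝ᵥ ψ) :=
    mul_le_mul_of_nonneg_left h2 (by positivity)
  linarith

/-- the covariance operator is invertible for `a, a₂ > 0` on a union of `L_P`-blocks. [folklore] -/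
theorem covLR_isUnit (hn : 1 ≤ n) {LP : ℕ} (hLP : 1 ≤ LP) {a a₂ : ℝ} (ha : 0 < a) (ha2 : 0 < a₂) {s : ℝ} (hs : 0 ≤ s)
    (hΩ : IsBlockUnion LP Ω) : IsUnit (covLR L hn LP Ω a a₂ s).det := by
  have hLP0 : (0 : ℝ) < LP := by exact_mod_cast hLP
  have hγ : 0 < min (a / (8 * (d + 1))) (1 / 8) * (min 2 a₂ / (LP : ℝ) ^ 2) := by
    refine mul_pos (lt_min (by positivity) (by norm_num)) (div_pos (lt_min (by norm_num) ha2) (by positivity))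
  exact isUnit_det_of_coercive _ hγ (covLR_form_ge L hn hLP ha ha2.le hs hΩ)

/-- `(Δ_s + a₂L_P^{−2}P)·(Δ_s + a₂L_P^{−2}P)⁻¹ = 1`. [folklore] -/
theorem covLR_mul_inv (hn : 1 ≤ n) {LP : ℕ} (hLP : 1 ≤ LP) {a a₂ : ℝ} (ha : 0 < a) (ha2 : 0 < a₂) {s : ℝ} (hs : 0 ≤ s)
    (hΩ : IsBlockUnion LP Ω) : covLR L hn LP Ω a a₂ s * (covLR L hn LP Ω a a₂ s)⁻¹ = 1 :=
  Matrix.mul_nonsing_inv _ (covLR_isUnit L hn hLP ha ha2 hs hΩ)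

end Cov

end Summit.QuantumFields.BalabanUV.T4Continuum.NE7K1LinRegionCovEnergy
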